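import Summits.RiemannHypothesis.RiemannHypothesis.Theorems.HandoffDodgerWitnessWindowCounting
import Summits.RiemannHypothesis.RiemannHypothesis.Theorems.HandoffDodgerCostSumFT
import HarnessLib

/-!
# HANDOFF — the WINDOW dodger witness under the COUNTING cumulant bound with the SHARP far tail (rh-explicit, W-P(P2) crux 19172 residue, seat prove-2 gen14; ATTEMPT-24 §2, brick FT part 7)

RH-FREE. HONEST FRAMING: nothing here bears on the truth of RH. dodger-p2's `HandoffDodgerWitnessWindowCounting.dodger_witness_window_counting`
VERBATIM except for the cost clause, which is taken from `HandoffDodgerCostSumFT.dodger_cost_le_ft` (far-zone bracket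
`(0.1615·log √(c/4) − 0.11)/√(c/4)` by Stieltjes integration instead of `N(√(c/4))/(e·c/4) + B(0,√(c/4))`; hypothesis `c = 4∫tD ≥ 4e¹⁶`).
The cost bound is written out in `hlt` (no definition). **`dodger_witness_window_counting_ft`**. No `sorry`, standard axioms, no definitions.

References: this track (ATTEMPT-16 §5–§6; ATTEMPT-19 §6–§7; ATTEMPT-23 §7; ATTEMPT-24 §1–§2; HOME/rh-explicit-dodger-p2/DODGER-STAGE2-PLAN.md §2 (c)).
-/

set_option linter.dupNamespace false

noncomputable section

open Complex Finset MeasureTheory Set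

namespace Summit.RiemannHypothesis.RiemannHypothesis.Theorems.Handoff

open Literature.NumberTheory.LFunctions Literature.NumberTheory.LFunctions.SchoenfeldBound Literature.NumberTheory.LFunctions.WeilContinuous
open scoped Real

/-- **THE DODGER WITNESS AT ONE PRIME with a free collar window, COUNTING cumulant bound, SHARP far tail** (dodger-p2's
`dodger_witness_window_counting` verbatim with the cost clause from `dodger_cost_le_ft`: `c = 4∫tD ≥ 4e¹⁶` and the Stieltjes far bracket,
written out in `hlt` — no definition). [this track, ATTEMPT-16 §6; ATTEMPT-19 §7; ATTEMPT-23 §7; ATTEMPT-24 §2] -/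
theorem dodger_witness_window_counting_ft {q q' : ℕ} {b T δ C α Ac Vc : ℝ} (n : ℕ) (hα0 : 0 ≤ α) (hα : α ≤ 1 / 2)
    (hbq1 : b + (bump n).rOut ≤ Real.log q / 2) (hbq2 : Real.log q / 2 ≤ b + 2 * (bump n).rOut)
    -- cost hypotheses (`dodger_cost_le_ft`)
    (hb : 0 < b) (hT2 : 2 ≤ T) (hK1 : 1 ≤ zetaZeroCount T) (hK : π * (zetaZeroCount T) / b ≤ T)
    {D : ℝ → ℝ} (hD : ContinuousOn D (Set.Icc 0 T)) (hD0 : ∀ t ∈ Set.Icc 0 T, 0 ≤ D t)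
    (hΔ : ∀ t ∈ Set.Icc 0 T, (zetaZeroCount t : ℝ) - ((min ⌊b * t / π⌋₊ (zetaZeroCount T) : ℕ) : ℝ) ≤ -D t)
    (hc : 4 * Real.exp 16 ≤ 4 * ∫ t in (0 : ℝ)..T, t * D t)
    (hgen : ∀ ρ : ℂ, riemannZeta ρ = 0 → 0 < ρ.im →
      ∀ k ∈ Finset.range (zetaZeroCount T), dodgerNode ρ - latticeFreq b (k + 1) ≠ 0)
    -- gain hypotheses (`dodger_collar_ge_window_counting`)
    (hAc : 0 ≤ Ac) (hVc : 0 < Vc) (hS : ∀ j, 2 ≤ j → ‖dodgerPowerSum b T j‖ ≤ (j : ℝ) * Ac * Vc ^ j)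
    (hp : 0 < (dodgerPowerSum b T 1).re) (hδb : δ ≤ b) (hεδ : 3 * (bump n).rOut ≤ δ)
    {N₁ N₂ : ℕ} (hN : N₁ ≤ N₂) (hVN : Vc * N₂ < (dodgerPowerSum b T 1).re)
    {X η lam ρ₁ ρ₂ τ₁ τ₂ : ℝ} (hX : (dodgerPowerSum b T 1).re * (2 * δ) ^ 2 ≤ X)
    (hη : Real.exp (Ac * (Vc * (N₁ : ℝ) / (dodgerPowerSum b T 1).re) ^ 2 / (1 - Vc * (N₁ : ℝ) / (dodgerPowerSum b T 1).re)) - 1 ≤ η)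
    (hlam : Ac * Vc ^ 2 * (N₂ : ℝ) / ((dodgerPowerSum b T 1).re ^ 2 * (1 - Vc * (N₂ : ℝ) / (dodgerPowerSum b T 1).re)) ≤ lam)
    (hρ₁ : Real.exp (3 + lam) * X / (4 * ((N₁ : ℝ) + 1) ^ 3) ≤ ρ₁) (hρ₁1 : ρ₁ < 1)
    (hρ₂ : Real.exp 2 * Vc * (2 * δ) ^ 2 / (2 * ((N₂ : ℝ) + 1) ^ 2) ≤ ρ₂) (hρ₂1 : ρ₂ < 1)
    (hτ₁ : ρ₁ ^ (N₁ + 1) / (1 - ρ₁) ≤ τ₁)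
    (hτ₂ : Real.exp ((dodgerPowerSum b T 1).re / (2 * Vc) + Ac / 2) * ρ₂ ^ (N₂ + 1) / (1 - ρ₂) ≤ τ₂)
    (hκ : 0 ≤ 1 - η - 3 * τ₁ - τ₂)
    -- the window
    (hδC : δ ≤ C * Real.log q ^ (3 / 2 : ℝ) * (q : ℝ) ^ (-(3 / 2 : ℝ))) (hwin : Real.log q / 2 + δ ≤ Real.log q' / 2)
    -- the one comparison
    (hlt : 2 * (4 * (Real.sinh (δ / 2) ^ 2 + 1) * Real.exp 1 *
            ((∏ k ∈ Finset.range (zetaZeroCount T), (latticeFreq b (k + 1)) ^ 2) /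
              ∏ ρ' ∈ zerosBetween 0 T, ‖dodgerNode ρ'‖ ^ (2 * (riemannZetaZeroOrder ρ').toNat)) ^ 2 *
            (4 * Real.cosh (b / 2) ^ 2 * (1 + b) ^ 2 / b ^ 2) *
          ((zetaZeroCount (2 * T) : ℝ) / T ^ 2 *
              Real.exp (4 * (b / π * (1 + Real.log ((zetaZeroCount T - 1 : ℕ) : ℝ))) -
                (4 * ∫ t in (0 : ℝ)..T, t * D t) / (2 * T + 1) ^ 2) +
            Real.exp (144 * (2 * ((zetaZeroCount T - 1 : ℕ) : ℝ)) ^ 2 / (7 * (4 * ∫ t in (0 : ℝ)..T, t * D t))) *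
              ((0.1615 * Real.log (Real.sqrt ((4 * ∫ t in (0 : ℝ)..T, t * D t) / 4)) - 0.11) /
                Real.sqrt ((4 * ∫ t in (0 : ℝ)..T, t * D t) / 4)))) <
      2 * Real.log q / Real.sqrt q *
        ((1 - 2 * α) * (2 * (δ - (bump n).rOut) - 4 * (bump n).rOut) *
          ((1 - η - 3 * τ₁ - τ₂) * ((1 / (2 * b)) * ((∏ k ∈ Finset.range (zetaZeroCount T), (latticeFreq b (k + 1)) ^ 2) /
        ∏ ρ ∈ zerosBetween 0 T, ‖dodgerNode ρ‖ ^ (2 * (riemannZetaZeroOrder ρ).toNat))) *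
            dodgerPhi ((dodgerPowerSum b T 1).re * (α * (2 * (δ - (bump n).rOut) - 4 * (bump n).rOut)) ^ 2)) ^ 2)) :
    ∃ θ : ℝ → ℂ, ∃ δ' B : ℝ, IsWeilTest θ ∧ tsupport θ ⊆ Icc (-(Real.log q / 2)) (Real.log q / 2) ∧ 0 ≤ δ' ∧
      δ' ≤ C * Real.log q ^ (3 / 2 : ℝ) * (q : ℝ) ^ (-(3 / 2 : ℝ)) ∧ Real.log q / 2 + δ' ≤ Real.log q' / 2 ∧
      (∀ U : ℝ, ∑ᶠ ρ ∈ weilZeroIndex U,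
          (riemannZetaZeroOrder ρ : ℝ) * ‖weilMellin (fun x ↦ θ (x - δ') - θ (x + δ')) ρ‖ ^ 2 ≤ B) ∧
      B < 2 * Real.log q / Real.sqrt q * (weilConv θ (weilReflect θ) (Real.log q - 2 * δ')).re := by
  set F₀ := cutoffCosPoly b (zetaZeroCount T) (dodgerCoeff b T (zetaZeroCount T)) with hF₀
  set θ := weilConv F₀ (moll n) with hθdef
  set r := (bump n).rOut with hr
  have hr0 : 0 < r := (bump n).rOut_pos
  have hδ0 : 0 ≤ δ := by linarith
  have hFi : Integrable F₀ := integrable_cutoffCosPoly b _ _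
  have hFs : HasCompactSupport F₀ :=
    HasCompactSupport.of_support_subset_isCompact (isCompact_Icc (a := -b) (b := b)) fun t ht => by
      have h : |t| ≤ b := le_of_not_gt fun h' => (Function.mem_support.1 ht) (cutoffCosPoly_eq_zero_of_lt h')
      exact Set.mem_Icc.2 (abs_le.1 h)
  have hθ : IsWeilTest θ := isWeilTest_weilConv_of_locallyIntegrable hFi.locallyIntegrable hFs (isWeilTest_moll n)
  refine ⟨θ, δ, 2 * (4 * (Real.sinh (δ / 2) ^ 2 + 1) * Real.exp 1 *
            ((∏ k ∈ Finset.range (zetaZeroCount T), (latticeFreq b (k + 1)) ^ 2) /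
              ∏ ρ' ∈ zerosBetween 0 T, ‖dodgerNode ρ'‖ ^ (2 * (riemannZetaZeroOrder ρ').toNat)) ^ 2 *
            (4 * Real.cosh (b / 2) ^ 2 * (1 + b) ^ 2 / b ^ 2) *
          ((zetaZeroCount (2 * T) : ℝ) / T ^ 2 *
              Real.exp (4 * (b / π * (1 + Real.log ((zetaZeroCount T - 1 : ℕ) : ℝ))) -
                (4 * ∫ t in (0 : ℝ)..T, t * D t) / (2 * T + 1) ^ 2) +
            Real.exp (144 * (2 * ((zetaZeroCount T - 1 : ℕ) : ℝ)) ^ 2 / (7 * (4 * ∫ t in (0 : ℝ)..T, t * D t))) *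
              ((0.1615 * Real.log (Real.sqrt ((4 * ∫ t in (0 : ℝ)..T, t * D t) / 4)) - 0.11) /
                Real.sqrt ((4 * ∫ t in (0 : ℝ)..T, t * D t) / 4)))), hθ, ?_, hδ0, hδC, hwin, ?_, ?_⟩
  · -- support in the `q`-subwindow
    exact (tsupport_dodgerWitness_subset b T n).trans (Icc_subset_Icc (by linarith) hbq1)
  · -- the cost (explicit-formula side)
    intro U
    have h := dodger_cost_le_ft hb hT2 hK1 hK hD hD0 hΔ hc hδ0 n hgen U
    exact h
  · -- the gain (collar side), at the shifted collar width `δ_g = δ − ((log q)/2 − b − r) ∈ [δ − r, δ]`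
    set δg := δ - (Real.log q / 2 - (b + r)) with hδg
    have hδg1 : δ - r ≤ δg := by rw [hδg]; linarith
    have hδg2 : δg ≤ δ := by rw [hδg]; linarith
    have hδg0 : 0 ≤ δg := by linarith
    have hsq : (2 * δg) ^ 2 ≤ (2 * δ) ^ 2 := pow_le_pow_left₀ (by linarith) (by linarith) 2
    have hXg : (dodgerPowerSum b T 1).re * (2 * δg) ^ 2 ≤ X := le_trans (mul_le_mul_of_nonneg_left hsq hp.le) hX
    have hρ₂g : Real.exp 2 * Vc * (2 * δg) ^ 2 / (2 * ((N₂ : ℝ) + 1) ^ 2) ≤ ρ₂ := by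
      refine le_trans ?_ hρ₂
      gcongr
    have hgain := dodger_collar_ge_window_counting n hα0 hα hb hAc hVc hS hp (hδg2.trans hδb) (by linarith) hN hVN hXg hη hlam
      hρ₁ hρ₁1 hρ₂g hρ₂1 hτ₁ hτ₂ hκ
    have hmono := windowGain_mono (T := T) (ε := r) (κ := 1 - η - 3 * τ₁ - τ₂) (α := α) hb hκ hp.le hα0 hα
      (by linarith) hδg1
    have hlag : Real.log q - 2 * δ = 2 * (b + r) - 2 * δg := by rw [hδg]; ring
    rw [hlag]
    have hlog : 0 ≤ Real.log q := by linarith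
    have hfac : 0 ≤ 2 * Real.log q / Real.sqrt q := by positivity
    calc 2 * (4 * (Real.sinh (δ / 2) ^ 2 + 1) * Real.exp 1 *
            ((∏ k ∈ Finset.range (zetaZeroCount T), (latticeFreq b (k + 1)) ^ 2) /
              ∏ ρ' ∈ zerosBetween 0 T, ‖dodgerNode ρ'‖ ^ (2 * (riemannZetaZeroOrder ρ').toNat)) ^ 2 *
            (4 * Real.cosh (b / 2) ^ 2 * (1 + b) ^ 2 / b ^ 2) *
          ((zetaZeroCount (2 * T) : ℝ) / T ^ 2 *
              Real.exp (4 * (b / π * (1 + Real.log ((zetaZeroCount T - 1 : ℕ) : ℝ))) -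
                (4 * ∫ t in (0 : ℝ)..T, t * D t) / (2 * T + 1) ^ 2) +
            Real.exp (144 * (2 * ((zetaZeroCount T - 1 : ℕ) : ℝ)) ^ 2 / (7 * (4 * ∫ t in (0 : ℝ)..T, t * D t))) *
              ((0.1615 * Real.log (Real.sqrt ((4 * ∫ t in (0 : ℝ)..T, t * D t) / 4)) - 0.11) /
                Real.sqrt ((4 * ∫ t in (0 : ℝ)..T, t * D t) / 4))))
        < 2 * Real.log q / Real.sqrt q *
          ((1 - 2 * α) * (2 * (δ - r) - 4 * r) *
            ((1 - η - 3 * τ₁ - τ₂) * ((1 / (2 * b)) * ((∏ k ∈ Finset.range (zetaZeroCount T), (latticeFreq b (k + 1)) ^ 2) /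
        ∏ ρ ∈ zerosBetween 0 T, ‖dodgerNode ρ‖ ^ (2 * (riemannZetaZeroOrder ρ).toNat))) *
              dodgerPhi ((dodgerPowerSum b T 1).re * (α * (2 * (δ - r) - 4 * r)) ^ 2)) ^ 2) := hlt
      _ ≤ 2 * Real.log q / Real.sqrt q *
          ((1 - 2 * α) * (2 * δg - 4 * r) *
            ((1 - η - 3 * τ₁ - τ₂) * ((1 / (2 * b)) * ((∏ k ∈ Finset.range (zetaZeroCount T), (latticeFreq b (k + 1)) ^ 2) /
        ∏ ρ ∈ zerosBetween 0 T, ‖dodgerNode ρ‖ ^ (2 * (riemannZetaZeroOrder ρ).toNat))) *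
              dodgerPhi ((dodgerPowerSum b T 1).re * (α * (2 * δg - 4 * r)) ^ 2)) ^ 2) :=
          mul_le_mul_of_nonneg_left hmono hfac
      _ ≤ 2 * Real.log q / Real.sqrt q * (weilConv θ (weilReflect θ) (2 * (b + r) - 2 * δg)).re :=
          mul_le_mul_of_nonneg_left hgain hfac

end Summit.RiemannHypothesis.RiemannHypothesis.Theorems.Handoff

end
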